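import Summits.CriticalPhenomena.PercolationContinuityZ3.Theorems.PercNearOneGluingNoHeavyLowerTailSunflowerUnionEdge
import HarnessLib

/-!
# `NoHeavyLowerTail` (crux stmt-CriticalPhenomena-4575), abstract sunflower cubic: AN A-SAFE GRAPH PLUS ANY NUMBER OF DISJOINT
# EDGES / COMPLETE BIPARTITE COMPONENTS IS A-SAFE (iteration of `…SunflowerUnionEdge`)

Support file (seat `prim-ineq-prove-1` gen 43; `--supports stmt-CriticalPhenomena-4575`).  No `sorry`, no named facts.
Memo: run/shared/lean/prim/prim-ineq-prove-1/FINDING-COSTGAME-prove1-g43.md §5.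

* **`safe_edgeCore_sup_matching`**: if `E` is a set of pairwise vertex-disjoint non-loop edges whose endpoints are isolated in `Γ₀`
  and `edgeCore Γ₀` is safe at `p`, then the core of `Γ₀ ⊔ fromEdgeSet E` (i.e. `Γ₀` plus the perfect matching `E` on fresh
  vertices) is safe at `p` — induction on `E` with `safe_edgeCore_add_edge`.
* **`aSafe_edgeCore_sup_matching_comap`**: hence every blow-up of such a graph is A-safe when `Γ₀` is: an A-safe graph plus ANY
  finite number of disjoint complete bipartite components `K_{m₁,n₁} ⊔ … ⊔ K_{m_r,n_r}` has an A-safe core (Lemma A for every number of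
  petals and every product measure; hence (C1-law), the H/G/T rows and Kahn-5 on complements by `…SunflowerSafeCalculus`).
-/

noncomputable section

namespace Summit.CriticalPhenomena.PercolationContinuityZ3.Theorems.SunflowerPartition

namespace SafeCalc

open MeasureTheory Finset
open Literature.Probability.LatticeModels Literature.Probability.Percolation

variable {ι : Type*} [DecidableEq ι] (p : ι → unitInterval)

/-- **An A-safe graph plus a disjoint matching is safe.**  `E` a finite set of non-loop, pairwise vertex-disjoint edges whose
endpoints are isolated in `Γ₀`: `Safe p (edgeCore Γ₀) → Safe p (edgeCore (Γ₀ ⊔ fromEdgeSet E))`. [this work] -/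
theorem safe_edgeCore_sup_matching [Fintype ι] (Γ₀ : SimpleGraph ι) :
    ∀ (E : Finset (Sym2 ι)), (∀ e ∈ E, ¬ e.IsDiag) →
      (∀ e ∈ E, ∀ e' ∈ E, e ≠ e' → ∀ v, v ∈ e → v ∉ e') →
      (∀ e ∈ E, ∀ v, v ∈ e → ∀ z, ¬ Γ₀.Adj v z) →
      Safe p (edgeCore Γ₀) → Safe p (edgeCore (Γ₀ ⊔ SimpleGraph.fromEdgeSet (↑E : Set (Sym2 ι)))) := by
  classical
  intro E
  induction E using Finset.induction_on with
  | empty =>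
    intro _ _ _ hsafe
    simpa using hsafe
  | insert e E heE ih =>
    intro hdiag hdisj hiso hsafe
    -- the smaller matching
    have hdiag' : ∀ e ∈ E, ¬ e.IsDiag := fun e he => hdiag e (mem_insert_of_mem he)
    have hdisj' : ∀ e ∈ E, ∀ e' ∈ E, e ≠ e' → ∀ v, v ∈ e → v ∉ e' :=
      fun e he e' he' hne v hv => hdisj e (mem_insert_of_mem he) e' (mem_insert_of_mem he') hne v hv
    have hiso' : ∀ e ∈ E, ∀ v, v ∈ e → ∀ z, ¬ Γ₀.Adj v z := fun e he v hv z => hiso e (mem_insert_of_mem he) v hv z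
    have IH := ih hdiag' hdisj' hiso' hsafe
    set Γ₁ := Γ₀ ⊔ SimpleGraph.fromEdgeSet (↑E : Set (Sym2 ι)) with hΓ₁
    -- the new edge `e = s(y₁, y₂)`
    induction e using Sym2.ind with
    | h y₁ y₂ =>
      have hne : y₁ ≠ y₂ := fun h => hdiag _ (mem_insert_self _ _) (Sym2.mk_isDiag_iff.2 h)
      -- its endpoints are isolated in `Γ₁`
      have hisoΓ₁ : ∀ v, v ∈ s(y₁, y₂) → ∀ z, ¬ Γ₁.Adj v z := by
        intro v hv z hadj
        rw [hΓ₁, SimpleGraph.sup_adj, SimpleGraph.fromEdgeSet_adj, Finset.mem_coe] at hadj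
        rcases hadj with h | ⟨hmem, -⟩
        · exact hiso _ (mem_insert_self _ _) v hv z h
        · have hne' : s(y₁, y₂) ≠ s(v, z) := fun h => heE (h ▸ hmem)
          exact hdisj _ (mem_insert_self _ _) _ (mem_insert_of_mem hmem) hne' v hv (Sym2.mem_mk_left v z)
      have h1 : ∀ z, ¬ Γ₁.Adj y₁ z := hisoΓ₁ y₁ (Sym2.mem_mk_left _ _)
      have h2 : ∀ z, ¬ Γ₁.Adj y₂ z := hisoΓ₁ y₂ (Sym2.mem_mk_right _ _)
      have key := safe_edgeCore_add_edge p Γ₁ hne h1 h2 IH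
      have hgraph : Γ₀ ⊔ SimpleGraph.fromEdgeSet (↑(insert s(y₁, y₂) E) : Set (Sym2 ι)) =
          Γ₁ ⊔ SimpleGraph.fromEdgeSet {s(y₁, y₂)} := by
        rw [hΓ₁, Finset.coe_insert, Set.insert_eq, SimpleGraph.fromEdgeSet_union, sup_assoc, sup_comm (SimpleGraph.fromEdgeSet _)]
      rw [hgraph]
      exact key

/-- **Blow-ups: an A-safe graph plus any number of disjoint complete bipartite components is A-safe.**  Every pull-back
`(Γ₀ ⊔ fromEdgeSet E).comap f` of "`Γ₀` plus a disjoint matching" has an A-safe core when `Γ₀` has (`aSafe_edgeCore_comap`). [this work] -/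
theorem aSafe_edgeCore_sup_matching_comap [Fintype ι] {κ : Type*} [Fintype κ] (f : κ → ι) (Γ₀ : SimpleGraph ι)
    (E : Finset (Sym2 ι)) (hdiag : ∀ e ∈ E, ¬ e.IsDiag) (hdisj : ∀ e ∈ E, ∀ e' ∈ E, e ≠ e' → ∀ v, v ∈ e → v ∉ e')
    (hiso : ∀ e ∈ E, ∀ v, v ∈ e → ∀ z, ¬ Γ₀.Adj v z) (hsafe : ∀ q : ι → unitInterval, Safe q (edgeCore Γ₀))
    (p' : κ → unitInterval) :
    Safe p' (edgeCore ((Γ₀ ⊔ SimpleGraph.fromEdgeSet (↑E : Set (Sym2 ι))).comap f)) :=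
  aSafe_edgeCore_comap f _ (fun q => safe_edgeCore_sup_matching q Γ₀ E hdiag hdisj hiso (hsafe q)) p'

end SafeCalc

end Summit.CriticalPhenomena.PercolationContinuityZ3.Theorems.SunflowerPartition
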